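import Summits.QuantumFields.QCD.Theses.PauliWegnerSea
import Summits.QuantumFields.QCD.Theorems.PauliWegnerSeaPhaseQuenchedFlavourDecayPionSecondMomentOfCrux
import Summits.QuantumFields.QCD.Theorems.PauliWegnerSeaGluonicCompletionDetNonvanishing
import Literature.MathematicalPhysics.QuantumFieldTheory.QCDPhaseQuenchedReweighting
import Literature.MathematicalPhysics.QuantumFieldTheory.QCDPhaseQuenchedPositivity
import Literature.MathematicalPhysics.QuantumFieldTheory.FermiFlavourPhase
import Literature.MathematicalPhysics.QuantumFieldTheory.QCDCurrentSector

/-!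
# Chirality transfer without a Wick hypothesis (line `Sketch`, crux `PauliWegnerSea.ChiralOneScaleTrajectory`,
stmt-QuantumFields-17512)

`chiralityTransfer_ae`: for every `N_f` with two distinct flavours `f ≠ g` and every regularisation `reg`,
the SIGNED SECOND-MOMENT ∀ ε : ℝ, 0 < ε → ∃ m : ℝ, 0 < m ∧ ∀ C : ℝ, ∃ᶠ k in atTop, ∃ S : ℕ, reg.L k ≤ S ∧ ∃ n : ℕ, n ≤ S ∧ C * Real.exp (-(ε * (reg.a k * n))) < ‖(∫ U : GaugeConfig 4 (2 * S + 1) (Matrix.specialUnitaryGroup (Fin 3) ℂ), (diracMatrix U fun _ : Fin Nf => reg.mcrit k + reg.a k * m / reg.Zm k).det * ((∑ a : Fin 3, ∑ i : Fin 4, ∑ b : Fin 3, ∑ j : Fin 4, ‖(diracMatrix U fun _ : Fin Nf => reg.mcrit k + reg.a k * m / reg.Zm k)⁻¹ (quarkEquiv (f, (Torus.proj (2 * S + 1) 0, a, i))) (quarkEquiv (f, (Torus.proj (2 * S + 1) (Pi.single 0 (n : ℤ)), b, j)))‖ ^ (2 : ℕ) : ℝ) : ℂ) ∂(wilsonMeasure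 (fundamentalRep (Fin 3)) (reg.β k))) / (∫ U : GaugeConfig 4 (2 * S + 1) (Matrix.specialUnitaryGroup (Fin 3) ℂ), (diracMatrix U fun _ : Fin Nf => reg.mcrit k + reg.a k * m / reg.Zm k).det ∂(wilsonMeasure (fundamentalRep (Fin 3)) (reg.β k)))‖ — for every rate `ε > 0` some positive renormalised mass `m` has, for every `C`,
frequently in `k`, one volume `S ≥ L_k` and one time-axis distance `n ≤ S` with
`C e^{-ε a_k n} < ‖(∫ det D · Σ_{a,i,b,j} |G_f((0,a,i),(n e₀,b,j))|² dμ_W)/(∫ det D dμ_W)‖` at the degenerate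
bare tuple `m_f(k) = m_crit(k) + a_k m/Z_m(k)` — implies `reg.IsChiralAtZero`.

Mechanism (Montvay–Münster 1994 §4.1 (4.25) Wick rule, §5.1.2 (5.15)–(5.16) γ₅-hermiticity; Mohler–Schaefer
2020 §2.1 sign reweighting): the honest connected correlator of the flavour-charged pion pair
`A = ψ̄_g γ₅ ψ_f`, `B = ψ̄_f γ₅ ψ_g` (`pseudoscalarDensityObs`, one-point functions vanish by the exact `U(1)_f`)
is `⟨W ⟨AB⟩_F⟩₊/⟨W⟩₊` (`qcdTorusExpect_eq_phaseQuenched`), whose almost-sure hypothesis `det D ≠ 0` `μ_W`-a.e.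
is DISCHARGED by the tree's `stub_detNonvanishing` (crux GluonicCompletion, line finite-sign-budget) and the
twisted free field (`det_diracMatrix_twistCfg_ne_zero`); configuration-wise `⟨AB⟩_F = −Σ|G_f|²`
(`pionPair_fermiRatio_eq`), and `|det D|·W = det D`, so the correlator is EXACTLY minus the signed quotient.
A frequently-violated certificate therefore contradicts `HasLatticeMassGap ε` at the positive tuple `(m,…,m)`.
This is the hypothesis-free form of the registered stub `stub_chiralityTransfer` (which takes the all-`U`
Wick numerator identity `stub_pionWickNumerator` as input instead of the a.e. fact).
-/

noncomputable section

namespace Summit.QuantumFields.QCD.Cruxes.ChiralOneScaleTrajectory.GoldstoneWitness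

open scoped BigOperators
open MeasureTheory Filter
open Literature.MathematicalPhysics.QuantumFieldTheory Literature.MathematicalPhysics.QuantumLattice
  Literature.Probability.LatticeModels
open Summit.QuantumFields.QCD.Cruxes.PhaseQuenchedFlavourDecay.CrossingSplitIntegrability
  (pionPair_fermiRatio_eq isFlavourCharged_pseudoscalarDensityObs_single pseudoscalarDensityObs_single_onTorus)
open Summit.QuantumFields.QCD.Theorems.FiniteSignBudgetAtTheSchemeVolume (stub_detNonvanishing)

/-- **The Wilson determinant is non-zero for `μ_W`-almost every gauge field**, on every torus, at every
coupling and every bare-mass tuple (tree `stub_detNonvanishing` + the twisted free field). -/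
theorem ae_det_diracMatrix_ne_zero {Nf S : ℕ} [NeZero S] (β : ℝ) (mq : Fin Nf → ℝ) :
    ∀ᵐ U : GaugeConfig 4 S SU3 ∂(wilsonMeasure (fundamentalRep (Fin 3)) β), (diracMatrix U mq).det ≠ 0 :=
  stub_detNonvanishing Nf S β mq ⟨TwistedFreeWilson.twistCfg S, det_diracMatrix_twistCfg_ne_zero mq⟩

/-- **The honest charged-pion correlator is minus the signed second-moment quotient** (any `N_f`, flavours
`f ≠ g` with equal bare masses, any torus side, coupling, distance):
`⟨(ψ̄_gγ₅ψ_f)(0) · (ψ̄_fγ₅ψ_g)(n e₀)⟩^conn = −(∫ det D · Σ_{a,i,b,j}|G_f((0,a,i),(ne₀,b,j))|² dμ_W)/(∫ det D dμ_W)`.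
[Montvay–Münster 1994 §4.1 (4.25), §5.1.2 (5.15); Mohler–Schaefer 2020 §2.1] -/
theorem pionCorr_eq_neg_signedQuotient {Nf S : ℕ} [NeZero S] (β : ℝ) (mq : Fin Nf → ℝ) {f g : Fin Nf}
    (hfg : f ≠ g) (hm : mq f = mq g) (n : ℕ) :
    qcdLatticeConnectedCorr β S mq (pseudoscalarDensityObs Nf (Matrix.single g f (1 : ℂ)))
        (pseudoscalarDensityObs Nf (Matrix.single f g (1 : ℂ))) n =
      -((∫ U : GaugeConfig 4 S SU3, (diracMatrix U mq).det *
            ((∑ a : Fin 3, ∑ i : Fin 4, ∑ b : Fin 3, ∑ j : Fin 4,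
              ‖(diracMatrix U mq)⁻¹ (quarkEquiv (f, (Torus.proj S 0, a, i)))
                  (quarkEquiv (f, (Torus.proj S (Pi.single 0 (n : ℤ)), b, j)))‖ ^ (2 : ℕ) : ℝ) : ℂ)
            ∂(wilsonMeasure (fundamentalRep (Fin 3)) β)) /
        (∫ U : GaugeConfig 4 S SU3, (diracMatrix U mq).det ∂(wilsonMeasure (fundamentalRep (Fin 3)) β))) := by
  have hcharged := isFlavourCharged_pseudoscalarDensityObs_single (Nf := Nf) hfg
  rw [hcharged.qcdLatticeConnectedCorr_eq one_ne_zero (pseudoscalarDensityObs Nf (Matrix.single f g (1 : ℂ)))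
      β S mq n,
    qcdTorusExpect_eq_phaseQuenched β mq _ (ae_det_diracMatrix_ne_zero β mq)]
  -- the configuration-wise Wick ratio
  have hfun : (fun U : GaugeConfig 4 S SU3 => qcdDetPhase U mq *
      (fermiIntegral ((pseudoscalarDensityObs Nf (Matrix.single g f (1 : ℂ))).onTorus S 0 U *
            (pseudoscalarDensityObs Nf (Matrix.single f g (1 : ℂ))).onTorus S (Pi.single 0 (n : ℤ)) U *
          fermiBoltzmann U mq) / fermiIntegral (fermiBoltzmann U mq))) =
      fun U => qcdDetPhase U mq * -((∑ a : Fin 3, ∑ i : Fin 4, ∑ b : Fin 3, ∑ j : Fin 4,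
              ‖(diracMatrix U mq)⁻¹ (quarkEquiv (f, (Torus.proj S 0, a, i)))
                  (quarkEquiv (f, (Torus.proj S (Pi.single 0 (n : ℤ)), b, j)))‖ ^ (2 : ℕ) : ℝ) : ℂ) := by
    funext U
    rw [pseudoscalarDensityObs_single_onTorus, pseudoscalarDensityObs_single_onTorus,
      pionPair_fermiRatio_eq U mq hfg hm _ _]
  rw [hfun]
  -- both phase-quenched expectations as quotients over `∫ |det D|`, which cancels
  have hZ : (∫ U, (‖(diracMatrix U mq).det‖ : ℂ) ∂(wilsonMeasure (d := 4) (L := S) (fundamentalRep (Fin 3)) β)) ≠ 0 := by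
    rw [integral_complex_ofReal, Complex.ofReal_ne_zero]
    exact (integral_norm_det_diracMatrix_pos_all β mq).ne'
  rw [qcdPhaseQuenchedExpect_eq_div_complex, qcdPhaseQuenchedExpect_eq_div_complex,
    div_div_div_cancel_right₀ hZ]
  have hnum : (fun U : GaugeConfig 4 S SU3 => (‖(diracMatrix U mq).det‖ : ℂ) * (qcdDetPhase U mq *
      -((∑ a : Fin 3, ∑ i : Fin 4, ∑ b : Fin 3, ∑ j : Fin 4,
          ‖(diracMatrix U mq)⁻¹ (quarkEquiv (f, (Torus.proj S 0, a, i)))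
              (quarkEquiv (f, (Torus.proj S (Pi.single 0 (n : ℤ)), b, j)))‖ ^ (2 : ℕ) : ℝ) : ℂ))) =
      fun U => -((diracMatrix U mq).det *
        ((∑ a : Fin 3, ∑ i : Fin 4, ∑ b : Fin 3, ∑ j : Fin 4,
          ‖(diracMatrix U mq)⁻¹ (quarkEquiv (f, (Torus.proj S 0, a, i)))
              (quarkEquiv (f, (Torus.proj S (Pi.single 0 (n : ℤ)), b, j)))‖ ^ (2 : ℕ) : ℝ) : ℂ)) := by
    funext U
    rw [← mul_assoc, norm_mul_qcdDetPhase, mul_neg]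
  have hden : (fun U : GaugeConfig 4 S SU3 => (‖(diracMatrix U mq).det‖ : ℂ) * qcdDetPhase U mq) =
      fun U => (diracMatrix U mq).det := by
    funext U
    rw [norm_mul_qcdDetPhase]
  rw [hnum, hden, integral_neg, neg_div]

/-- **Chirality transfer, hypothesis-free form.** For every `N_f` with two distinct flavours `f ≠ g` and
every regularisation, the signed second-moment pin at the degenerate tuple implies `reg.IsChiralAtZero`:
the uniform lattice gap `ε` at the positive tuple `(m,…,m)` would bound the charged-pion correlator by
`C e^{-ε a_k n}` eventually in `k`, while the pin makes the same correlator (= the signed quotient in norm)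
exceed it frequently. -/
theorem chiralityTransfer_ae :
    ∀ (Nf : ℕ) (f g : Fin Nf), f ≠ g → ∀ reg : QCDRegularisation Nf, (∀ ε : ℝ, 0 < ε → ∃ m : ℝ, 0 < m ∧ ∀ C : ℝ, ∃ᶠ k in atTop, ∃ S : ℕ, reg.L k ≤ S ∧ ∃ n : ℕ, n ≤ S ∧ C * Real.exp (-(ε * (reg.a k * n))) < ‖(∫ U : GaugeConfig 4 (2 * S + 1) (Matrix.specialUnitaryGroup (Fin 3) ℂ), (diracMatrix U fun _ : Fin Nf => reg.mcrit k + reg.a k * m / reg.Zm k).det * ((∑ a : Fin 3, ∑ i : Fin 4, ∑ b : Fin 3, ∑ j : Fin 4, ‖(diracMatrix U fun _ : Fin Nf => reg.mcrit k + reg.a k * m / reg.Zm k)⁻¹ (quarkEquiv (f, (Torus.proj (2 * S + 1) 0, a, i))) (quarkEquiv (f, (Torus.proj (2 * S + 1) (Pi.single 0 (n : ℤ)), b, j)))‖ ^ (2 : ℕ) : ℝ) : ℂ) ∂(wilsonMeasure (fundamentalRep (Fin 3)) (reg.β k))) / (∫ U : GaugeConfig 4 (2 * S + 1) (Matrix.specialUnitaryGroup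 (Fin 3) ℂ), (diracMatrix U fun _ : Fin Nf => reg.mcrit k + reg.a k * m / reg.Zm k).det ∂(wilsonMeasure (fundamentalRep (Fin 3)) (reg.β k)))‖) → reg.IsChiralAtZero := by
  intro Nf f g hfg reg hpin ε hε
  obtain ⟨m₀, hm₀, hC⟩ := hpin ε hε
  refine ⟨fun _ => m₀, fun _ => hm₀, fun hgap => ?_⟩
  obtain ⟨C, hev⟩ := hgap 1 1 (pseudoscalarDensityObs Nf (Matrix.single g f (1 : ℂ)))
    (pseudoscalarDensityObs Nf (Matrix.single f g (1 : ℂ)))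
  obtain ⟨k, ⟨S, hS, n, hn, hlt⟩, hk⟩ := ((hC C).and_eventually hev).exists
  have hle := hk S hS n hn
  have hmq : (fun fl => (reg.scheme (fun _ : Fin Nf => m₀) 0 0).mq fl k) =
      fun _ : Fin Nf => reg.mcrit k + reg.a k * m₀ / reg.Zm k := by
    funext fl
    simp [QCDRegularisation.scheme_mq]
  rw [hmq, pionCorr_eq_neg_signedQuotient _ _ hfg rfl n, norm_neg] at hle
  exact (lt_irrefl _) (hlt.trans_le hle)

end Summit.QuantumFields.QCD.Cruxes.ChiralOneScaleTrajectory.GoldstoneWitness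

end
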